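import Literature.GroupTheory.CombinatorialGroupTheory.RandomSclFreeGroupSharpUpperTail
import HarnessLib

/-!
# Random rigidity of scl (Calegari–Walker 2013): the Random Rigidity Theorem from its two halves

D. Calegari, A. Walker, *Random rigidity in the free group*, Geom. Topol. **17** (2013) 1707–1744
[CalegariWalker2013], §4.4: "The Random Rigidity Theorem (Theorem 4.1) follows immediately from
these two propositions" — the upper bound Prop. 4.2 (`scl(v) log n / n ≤ log(2k−1)/6 + ε` with
probability `1 − O(n^{−C})`, indeed with an exponential tail) and the lower bound Prop. 4.9
(`log(2k−1)/6 − scl(v) log n / n ≤ ε` with probability `1 − O(n^{−C})`).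

This file records that decomposition of the named fact `CalegariWalker2013_randomRigidity`
(`RandomSclFreeGroup.lean`) into its two printed halves, both rendered on the uniform measure on
`commutatorWords k n = F_n ∩ [F,F]` exactly as the parent is:

* `CalegariWalker2013_sclUpperBound` — Prop. 4.2, PROVED here (`CalegariWalker2013_sclUpperBound_holds`)
  from `CalegariWalker2013_sclUpperTail` (`RandomSclFreeGroupSharpUpperTail.lean`, parts 1–23 of the
  proofs);
* `CalegariWalker2013_sclLowerBound` — Prop. 4.9 (the comb analysis of §4.5–4.7, Lemmas 4.12–4.14;
  groundwork in parts 24–37, `RandomSclFreeGroupComb*`, `RandomSclFreeGroupToken*`,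
  `RandomSclFreeGroupFan*`); the weaker constant `1/12` (Prop. 5.4) is the proved
  `CalegariWalker2013_sclLowerTail` (`RandomSclFreeGroupLowerTail.lean`);
* `CalegariWalker2013_randomRigidity_holds_of` — the assembly: the two-sided deviation event is
  contained in the union of the two one-sided ones (union bound, `K = K₁ + K₂`).

## References

* [CalegariWalker2013] D. Calegari, A. Walker, *Random rigidity in the free group*, Geom. Topol.
  17 (2013) 1707–1744, doi:10.2140/gt.2013.17.1707; arXiv:1104.1768: Thm. 4.1, Prop. 4.2, Prop. 4.9,
  §4.4 (p. 11 of the arXiv version: "follows immediately from these two propositions").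
-/

noncomputable section

open Filter

namespace Literature.GroupTheory.CombinatorialGroupTheory

open scoped Classical

/-- **Calegari–Walker 2013, Prop. 4.2 (upper bound).** *Let `v` be a random reduced word of
length `n`, conditioned to lie in `[F,F]`, `F` free of rank `k ≥ 2`. Then for any `ε > 0` and
`C > 1`, `scl(v) log(n)/n − log(2k−1)/6 ≤ ε` with probability `1 − O(n^{−C})`* (the printed
statement even has an exponential tail `1 − O(C^{−n^c})`; the polynomial form is what Thm. 4.1
uses). Rendered on the uniform measure on `commutatorWords k n` as in
`CalegariWalker2013_randomRigidity`: there is `K` such that for all large `n` the number of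
`w ∈ F_n'` with `log(2k−1)/6 + ε < scl(w) log(n)/n` is at most `K · n^{−C} · #F_n'`.
[cite: CalegariWalker2013, Prop. 4.2] -/
def CalegariWalker2013_sclUpperBound : Prop :=
  ∀ k : ℕ, 2 ≤ k → ∀ ε : ℝ, 0 < ε → ∀ C : ℝ, 1 < C → ∃ K : ℝ, ∀ᶠ n : ℕ in atTop,
    ((((commutatorWords k n).filter fun w =>
        Real.log (2 * k - 1) / 6 + ε <
          stableCommutatorLength (FreeGroup.mk (List.ofFn w)) * Real.log n / n).card : ℕ) : ℝ) ≤
      K * (n : ℝ) ^ (-C) * ((commutatorWords k n).card : ℝ)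

/-- Prop. 4.2 is proved in the tree: `CalegariWalker2013_sclUpperTail`
(`RandomSclFreeGroupSharpUpperTail.lean`). [cite: CalegariWalker2013, Prop. 4.2] -/
theorem CalegariWalker2013_sclUpperBound_holds : CalegariWalker2013_sclUpperBound :=
  fun k hk ε hε C hC => CalegariWalker2013_sclUpperTail k hk ε hε C hC

/-- **Calegari–Walker 2013, Prop. 4.9 (lower bound).** *Let `v` be a random reduced word in the
commutator subgroup of length `n` (`F` free of rank `k ≥ 2`). Then for any `ε > 0` and any `C`,
`log(2k−1)/6 − scl(v) log(n)/n ≤ ε` with probability `1 − O(n^{−C})`.* Rendered on the uniform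
measure on `commutatorWords k n` as in `CalegariWalker2013_randomRigidity`: there is `K` such that
for all large `n` the number of `w ∈ F_n'` with `scl(w) log(n)/n < log(2k−1)/6 − ε` is at most
`K · n^{−C} · #F_n'` (`C > 1` suffices for Thm. 4.1 and implies the statement for smaller `C`).
Printed proof: §4.5–4.7 (combs, `δ`-regularity Lemma 4.12, overlap estimate Lemma 4.13, comb
estimate Lemma 4.14, and the combinatorial estimate Lemma 3.7 relating `scl` to the average edge
length of an extremal fatgraph). The weaker constant `1/12` (Prop. 5.4) is the proved
`CalegariWalker2013_sclLowerTail`. [cite: CalegariWalker2013, Prop. 4.9 (§4.7)] -/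
def CalegariWalker2013_sclLowerBound : Prop :=
  ∀ k : ℕ, 2 ≤ k → ∀ ε : ℝ, 0 < ε → ∀ C : ℝ, 1 < C → ∃ K : ℝ, ∀ᶠ n : ℕ in atTop,
    ((((commutatorWords k n).filter fun w =>
        stableCommutatorLength (FreeGroup.mk (List.ofFn w)) * Real.log n / n <
          Real.log (2 * k - 1) / 6 - ε).card : ℕ) : ℝ) ≤
      K * (n : ℝ) ^ (-C) * ((commutatorWords k n).card : ℝ)

/-- **Assembly (Calegari–Walker 2013, §4.4): Thm. 4.1 from Props. 4.2 and 4.9.** The two-sided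
deviation event `ε < |scl(w) log(n)/n − log(2k−1)/6|` is contained in the union of the two
one-sided events, so the counts add and `K = K₁ + K₂` works.
[cite: CalegariWalker2013, §4.4 (Thm. 4.1 from Props. 4.2, 4.9)] -/
theorem CalegariWalker2013_randomRigidity_holds_of
    (hU : CalegariWalker2013_sclUpperBound) (hL : CalegariWalker2013_sclLowerBound) :
    CalegariWalker2013_randomRigidity := by
  intro k hk ε hε C hC
  obtain ⟨K₁, h₁⟩ := hU k hk ε hε C hC
  obtain ⟨K₂, h₂⟩ := hL k hk ε hε C hC
  refine ⟨K₁ + K₂, ?_⟩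
  filter_upwards [h₁, h₂] with n hn₁ hn₂
  set c : ℝ := Real.log (2 * k - 1) / 6 with hc
  set U := (commutatorWords k n).filter fun w =>
      c + ε < stableCommutatorLength (FreeGroup.mk (List.ofFn w)) * Real.log n / n with hUdef
  set L := (commutatorWords k n).filter fun w =>
      stableCommutatorLength (FreeGroup.mk (List.ofFn w)) * Real.log n / n < c - ε with hLdef
  have hsub : ((commutatorWords k n).filter fun w =>
      ε < |stableCommutatorLength (FreeGroup.mk (List.ofFn w)) * Real.log n / n - c|) ⊆ U ∪ L := by
    intro w hw
    rw [Finset.mem_filter] at hw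
    obtain ⟨hw, hεw⟩ := hw
    rw [Finset.mem_union, hUdef, hLdef, Finset.mem_filter, Finset.mem_filter]
    rcases lt_abs.mp hεw with h | h
    · exact Or.inl ⟨hw, by linarith⟩
    · exact Or.inr ⟨hw, by linarith⟩
  have hcard : (((commutatorWords k n).filter fun w =>
      ε < |stableCommutatorLength (FreeGroup.mk (List.ofFn w)) * Real.log n / n - c|).card : ℝ) ≤
      (U.card : ℝ) + (L.card : ℝ) := by
    have h := (Finset.card_le_card hsub).trans (Finset.card_union_le U L)
    exact_mod_cast h
  calc (((commutatorWords k n).filter fun w =>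
        ε < |stableCommutatorLength (FreeGroup.mk (List.ofFn w)) * Real.log n / n - c|).card : ℝ)
      ≤ (U.card : ℝ) + (L.card : ℝ) := hcard
    _ ≤ K₁ * (n : ℝ) ^ (-C) * ((commutatorWords k n).card : ℝ) +
        K₂ * (n : ℝ) ^ (-C) * ((commutatorWords k n).card : ℝ) := add_le_add hn₁ hn₂
    _ = (K₁ + K₂) * (n : ℝ) ^ (-C) * ((commutatorWords k n).card : ℝ) := by ring

end Literature.GroupTheory.CombinatorialGroupTheory

end
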